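import Summits.QuantumFields.YangMills.Theorems.BalabanUVNodesN14DecoupledDressing
import Summits.QuantumFields.YangMills.Theorems.BalabanUVNodesN14AtRateRecord13CoPHOn

/-!
# DAG node N14 · NE1′ — THE NONDEGENERACY GUARD FOR N14's CARRIERS `ne1` (the dressed tower), ITS JUNK DOORS IN KERNEL, AND A
# GUARD-PASSING INHABITANT OVER THE RECORD's BOXES AT THE STAGE-13 KEYS (plan g77's ask (q2) for N14; W-SEAT-START-LIST v2 §2 n14 ITEM 2)

Cell `pub-ymgap`, YM-PLAN Track A (HUMAN RULING D-0062 ∕ D-0149 work-bound push), width seat `pub-ymgap-dag-n14-w2` (g0); `--kind proof --supports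
stmt-QuantumFields-20544` (K3⁷ `SpineGivenEndpointR13SepCoPH`) `--as helper` — COUNT-NEUTRAL.  ADDITIVE: imports dag-n14-c's model rung
`Thm/BalabanUVNodesN14DecoupledDressing` (p459546: `Decoupled.DecoupledRun ∕ booking ∕ trajectory ∕ tower ∕ carriers ∕ twoPoint`, `classAt_tower`,
`positionalCount_tower`, `birthSize_twoPoint_zero_pos`) and this lineage's ₁₃ home face `Thm/BalabanUVNodesN14AtRateRecord13CoPHOn` (p543529: `s_N14_rRec₁₃CoPHOn_of_n14At`;
through it `RateReading₁₃CoPH`, `RRec₁₃CoPHOn`, the owner's `toyTower`); modifies nothing; every cited declaration is used BY NAME.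

WHY THIS FILE (plan g77 YMPLAN-G77-K3STUB1-DECISION, INBOX l.23415, and K3V2-DRAFT-TYPED l.23852).  dag-n18-e's evidence #5 `K3Stub1ShadowSepCoPH.lean`
(`keyedRates_junk`) shows that the K3⁷ stub's ∃-currency over rate readings admits, in N14's slot, THE EMPTY DRESSED TOWER `junkNE1 := ⟨PEmpty, junkTower, 0⟩`
(`n14At_junk`: `DressedStabilityStrict` with `A₀ = ρ₁ = τ = 0`).  The v2 skeleton pins `rr.ne1` either to a record object BY NAME or — plan's fallback — by a
NONDEGENERACY GUARD «nonempty tower index over the record's boxes» placed where `∃ ne1` stands.  FIRST-HAND (q2) ANSWER FOR N14: the tree holds NO dressed tower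
OF RECORD (NODE O's observable-attached booking of Bałaban's run `(ℝ′𝕋)^k(ρ₀·f_μ)` is not constructed; `RateReading₁₃CoPH.ne1` and `readingOfRecord₁₃CoPH … ne1`'s
`ne1` are PARAMETERS), so the guard is what can be typed today.  This file types it over the tree's own `DressedTower ∕ NE1pCarriers`, proves in kernel which junk it
closes and which it does not, and exhibits a guard-passing inhabitant carrying `N14At` at the ₁₃ keys whose index IS over the record's boxes.

* §1 THE GUARD [shapes, Prop-valued]: `BirthsNonempty 𝒯` (every booking HAS a booked member), `NotVacuum 𝒯` (SOME booked size is positive in the booked range —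
  existential on purpose: genuine dressed terms vanish identically at zero source), **`Nondegenerate c := Nonempty c.P ∧ BirthsNonempty c.𝒯 ∧ NotVacuum c.𝒯`** — THE
  GUARD OFFERED FOR THE RECORD (it KEEPS a TOP-BORN tower — every term born at the final scale `K`, director-ym №195 (8) reading (a) as located by dag-n14-w1, INBOX
  l.24096 — and the scale-decoupled one alike); the STRONGER VARIANT `MemberPerScale 𝒯` («≥ 1 booked member of EVERY scale `j ≤ K`», the W-SEAT-START-LIST wording;
  met by dag-n14-c's decoupled tower, NOT by a top-born one) with `NondegeneratePerScale c` and `nondegenerate_of_perScale` — DEFINED AND TESTED here, NOT asserted of the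
  record (plan's word picks the variant); the RATE CLAUSE `RateCovers c N₀` (the carriers'
  positional rate `c.Λ` COVERS the bookings' positional counts with multiplicity `N₀` — `Λ` is not a free letter: dag-n14-a's `n14At_growing_quarter` shows the
  doubling tower passes `N14At` at `Λ = ¼`) with its consumer face `dressedBudget_of_n14At_rateCovers` (ROOT-B by the owner's `dressedBudget_of_dressedStabilityStrict`);
  the KEYED form `Ne1NondegenerateOn 𝔯 Rg` at every admissible Stage-13 tuple with provisos in the regime `Rg` (at `Rg := Node00.unityNondeg₁₃H N` its binder prefix
  is the K3 skeleton's `Keyed…` prefix restricted to N14).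
* §2 THE JUNK DOORS [kernel]: `N14At` HOLDS at every carriers with EMPTY run-parameter type (`n14At_of_isEmpty` — n18-e's `junkNE1`), with NO births
  (`n14At_of_births_isEmpty`), or with ALL SIZES ZERO (`n14At_of_size_eq_zero`) — and each FAILS the guard (`not_nondegenerate_of_isEmpty ∕ _of_births_isEmpty ∕
  _of_size_eq_zero`); the owner's decided `toyTower` (one scale-0 family per cutoff, positive sizes) PASSES the guard (`nondegenerate_toyTower`) and FAILS only the
  per-scale variant (`not_memberPerScale_toyTower`).  HONEST: a guard EXCLUDES junk; it does NOT tie `ne1` to Bałaban's run — a tower with one arbitrary small positive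
  member passes it and may carry `N14At` with no content about Bałaban's run
  (§3's model inhabitant carries `N14At` from the printed (1.73)–(1.75) provisos, nothing of Bałaban's run); that tie is NODE O's object (cf. n18-e §4: letter guards do not bind U3's functionals either).
* §3 THE INHABITANT OVER THE RECORD's BOXES [model, by name]: `BoxPt γ` (a run length and a coupling history in `FlowStep.Box γ k`; inhabited iff `0 < γ`),
  `towerOverBoxes R γ` = dag-n14-c's scale-decoupled tower RE-INDEXED over `BoxPt γ × (source window)` (the box coordinate is IDLE in the bookings — the caricature is
  blind to the coupling history; said, not hidden), `carriersOverBoxes R γ Λ`, the reading `ne1OverBoxes R Λ F θ hP g₀ os := carriersOverBoxes R θ.γ Λ` (READS θ: the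
  record's window radius); `tiltNorm_twoPoint ∕ birthSize_twoPoint_pos` (EVERY depth's born term of the two-point run at source `1` is `log cosh(½(½)ⁿ) > 0` —
  n14-c proved depth `0`); `nondegenerate_carriersOverBoxes_twoPoint (0 < γ)`, `rateCovers_carriersOverBoxes (1 ≤ Λ)`, `n14At_carriersOverBoxes (0 ≤ Λ, Λ·θ < 1)`;
  keyed: **`ne1NondegenerateOn_ne1OverBoxes_twoPoint`** (the guard at EVERY admissible tuple — `0 < θ.γ` from admissibility) and
  **`s_N14_rRec₁₃CoPHOn_ne1OverBoxes`** (`S_N14` at the regime-restricted home for the reading `⟨lit, ne1OverBoxes R Λ⟩`, ONE application of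
  `s_N14_rRec₁₃CoPHOn_of_n14At`); `guard_and_s_N14_twoPoint` packages both at `Λ = 1`: the guarded slot is JOINTLY satisfiable with the node statement (A6 hygiene).

HONEST FRAMING.  Count-neutral kernel bookkeeping plus a MODEL inhabitant; nothing of Bałaban's densities is asserted or instantiated; NE1′ is NOT PRINTED
([Balaban1989LargeFieldII] (1.73)–(1.75) pp. 379–380 type the action only; p. 356 defers observables) and NOT PROVED; N14 NOT discharged (typed 28∕28 · discharged
5∕27, A 5∕28 — UNMOVED); K3⁷ OPEN, not claimed; the R3 acceptance of the v2 skeleton is the plan's.  One finite four-torus programme at fixed `ε`; R4 closes only the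
conditional finite-𝕋⁴ rung `BalabanLadder.UV` — NOT infinite volume, NOT OS on ℝ⁴, NOT a mass gap, NOT Clay.  [folklore] kernel mathematics; 0 sorry; standard axioms.
-/

noncomputable section

namespace YMDAG.N14.TowerGuard

open MeasureTheory Finset
open scoped BigOperators
open Literature.MathematicalPhysics.QuantumFieldTheory.Balaban1983to89
open Literature.MathematicalPhysics.QuantumFieldTheory.Balaban1983to89.T4Continuum
open Literature.MathematicalPhysics.QuantumFieldTheory.Balaban1983to89.T4TermFormat
open Literature.MathematicalPhysics.QuantumFieldTheory.Balaban1983to89.B16Ineq175Tilted (tiltWeight tiltWeight_apply)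
open Literature.MathematicalPhysics.QuantumFieldTheory.Balaban1983to89.B16DressedActionTerm
open Summit.QuantumFields.BalabanUV.T4Continuum.NE1p.DressedRoot
open YMDAG.UVSplit
open YMDAG.N14.Decoupled (DecoupledRun booking trajectory tower carriers amp birthSize twoPoint twoPointMeasure twoPointW)
open Node00 (Stage13HParams)

variable {N : ℕ} [NeZero N]

/-! ## §1 The guard on N14's carriers, the rate clause, and the keyed form at the Stage-13 tuples -/

/-- **EVERY BOOKING HAS A MEMBER** [shape]: at every run parameter `p` and cutoff `K` the booking of the observable-attached terms is not empty (the weakest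
«non-empty tower» clause; a TOP-BORN tower — every term born at the final scale — meets it). [folklore] -/
def BirthsNonempty {P : Type*} (𝒯 : DressedTower P) : Prop :=
  ∀ (p : P) (K : ℕ), Nonempty (𝒯.B p K).Birth

/-- **≥ 1 BOOKED MEMBER OF EVERY SCALE** [shape, the STRONGER variant — defined and tested here, NOT asserted of the record]: at every run parameter `p` and cutoff
`K`, every scale `j ≤ K` is the birth scale of some booked observable-attached term (a run that books dressed terms at every step, e.g. dag-n14-c's scale-decoupled
tower; a top-born tower does NOT meet it for `K ≥ 1`). [folklore] -/
def MemberPerScale {P : Type*} (𝒯 : DressedTower P) : Prop :=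
  ∀ (p : P) (K j : ℕ), j ≤ K → ∃ b : (𝒯.B p K).Birth, (𝒯.B p K).birthScale b = j

/-- The per-scale clause implies the non-empty one (take `j = 0`). [folklore] -/
theorem birthsNonempty_of_memberPerScale {P : Type*} {𝒯 : DressedTower P} (h : MemberPerScale 𝒯) : BirthsNonempty 𝒯 :=
  fun p K => let ⟨b, _⟩ := h p K 0 (Nat.zero_le K); ⟨b⟩

/-- **NOT THE VACUUM** [shape]: SOME booked size is positive inside the booked range `birthScale b ≤ k ≤ K` (existential on purpose: genuine dressed terms vanish
identically at zero source, so positivity cannot be asked at every run parameter). [folklore] -/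
def NotVacuum {P : Type*} (𝒯 : DressedTower P) : Prop :=
  ∃ (p : P) (K : ℕ) (b : (𝒯.B p K).Birth) (k : ℕ), (𝒯.B p K).birthScale b ≤ k ∧ k ≤ K ∧ 0 < (𝒯.B p K).size b k

/-- **THE NONDEGENERACY GUARD ON N14's CARRIERS** [shape — the guard OFFERED FOR THE RECORD]: the run-parameter index is inhabited, every booking has a member, and
the tower is not the vacuum.  What the K3⁷ v2 skeleton can conjoin where `∃ ne1` stands (plan g77 (q2) fallback «nonempty tower index over the record's boxes»); keeps
top-born and scale-decoupled towers alike. [folklore] -/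
def Nondegenerate (c : NE1pCarriers) : Prop :=
  Nonempty c.P ∧ BirthsNonempty c.𝒯 ∧ NotVacuum c.𝒯

/-- **THE PER-SCALE VARIANT** [shape, stronger; plan's word picks]: as `Nondegenerate` with «a booked member of EVERY scale». [folklore] -/
def NondegeneratePerScale (c : NE1pCarriers) : Prop :=
  Nonempty c.P ∧ MemberPerScale c.𝒯 ∧ NotVacuum c.𝒯

/-- The per-scale variant implies the guard. [folklore] -/
theorem nondegenerate_of_perScale {c : NE1pCarriers} (h : NondegeneratePerScale c) : Nondegenerate c :=
  ⟨h.1, birthsNonempty_of_memberPerScale h.2.1, h.2.2⟩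

/-- **THE RATE CLAUSE** [shape]: the carriers' positional rate `c.Λ` COVERS the bookings' positional counts with a K-free multiplicity `N₀ ≥ 0` — at most `N₀·Λ^{k−j}`
births of scale `j` are felt at any cube of scale `k` (`T4TermFormat.Booking.PositionalCount`).  Ties the letter `Λ` of `N14At c = DressedStabilityStrict c.𝒯 c.Λ` to the
tower (dag-n14-a: the doubling tower passes `N14At` at `Λ = ¼`, `n14At_growing_quarter`, and fails it at its honest rate `Λ = 1`, `not_n14At_growing_one`). [folklore] -/
def RateCovers (c : NE1pCarriers) (N₀ : ℝ) : Prop :=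
  0 ≤ N₀ ∧ ∀ (p : c.P) (K : ℕ), (c.𝒯.B p K).PositionalCount fun j k => N₀ * c.Λ ^ (k - j)

/-- **CONSUMER FACE OF THE RATE CLAUSE** [bookkeeping]: `N14At` together with `RateCovers` gives ROOT-B `DressedBudget` for every run-weight profile with values in
`[0, w̄]` — the owner's `dressedBudget_of_dressedStabilityStrict` BY NAME. [folklore] -/
theorem dressedBudget_of_n14At_rateCovers {c : NE1pCarriers} {N₀ wbar : ℝ} {w : c.P → ℕ → ℕ → ℝ} (h : N14At c) (hc : RateCovers c N₀)
    (hwbar : 0 ≤ wbar) (hw0 : ∀ p K, ∀ j ≤ K, 0 ≤ w p K j) (hwb : ∀ p K, ∀ j ≤ K, w p K j ≤ wbar) : DressedBudget c.𝒯 w :=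
  dressedBudget_of_dressedStabilityStrict h hc.1 hwbar hw0 hwb hc.2

/-- **THE KEYED GUARD AT THE STAGE-13 TUPLES** [shape]: the reading's dressed-tower assignment `𝔯.ne1 F θ hP g₀ os` is nondegenerate at EVERY admissible Stage-13
tuple with provisos in the regime `Rg` — the binder prefix of the home's `s_N14_rRec₁₃CoPHOn_iff`; at `Rg := Node00.unityNondeg₁₃H N` (`θ.ZhUnity F N ∧
θ.SlotsNondegenerate₁₃ F N`) it is the K3⁷ skeleton's `Keyed…` prefix restricted to N14. [folklore] -/
def Ne1NondegenerateOn (𝔯 : RateReading₁₃CoPH N) (Rg : (F : T4Family) → Stage13HParams F N → Prop) : Prop :=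
  ∀ (F : T4Family) (θ : Stage13HParams F N) (hP : θ.Provisos₁₃CoPH F N), Rg F θ → θ.Admissible F N →
    ∀ (g₀ : ℕ → ℝ) (os : List (ULoop F)), Nondegenerate (𝔯.ne1 F θ hP g₀ os)

/-- The keyed guard is antitone in the regime. [folklore] -/
theorem ne1NondegenerateOn_anti {𝔯 : RateReading₁₃CoPH N} {Rg Rg' : (F : T4Family) → Stage13HParams F N → Prop} (h : ∀ F θ, Rg F θ → Rg' F θ)
    (hn : Ne1NondegenerateOn 𝔯 Rg') : Ne1NondegenerateOn 𝔯 Rg :=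
  fun F θ hP hRg hθ g₀ os => hn F θ hP (h F θ hRg) hθ g₀ os

/-- The keyed guard reads `𝔯.ne1` only. [folklore] -/
theorem ne1NondegenerateOn_iff_of_ne1_eq {𝔯 𝔯' : RateReading₁₃CoPH N} (Rg : (F : T4Family) → Stage13HParams F N → Prop)
    (h : ∀ (F : T4Family) (θ : Stage13HParams F N) (hP : θ.Provisos₁₃CoPH F N) (g₀ : ℕ → ℝ) (os : List (ULoop F)), 𝔯.ne1 F θ hP g₀ os = 𝔯'.ne1 F θ hP g₀ os) :
    Ne1NondegenerateOn 𝔯 Rg ↔ Ne1NondegenerateOn 𝔯' Rg := by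
  constructor
  · intro hn F θ hP hRg hθ g₀ os
    rw [← h F θ hP g₀ os]
    exact hn F θ hP hRg hθ g₀ os
  · intro hn F θ hP hRg hθ g₀ os
    rw [h F θ hP g₀ os]
    exact hn F θ hP hRg hθ g₀ os

/-! ## §2 The junk doors: where `N14At` holds with no content, and that the guard closes each -/

section Junk

/-- **DOOR 1 — EMPTY RUN-PARAMETER TYPE** [decided]: `N14At` holds at every carriers with no run parameter and `0 ≤ Λ` (`A₀ = ρ₁ = τ = 0`, `r = ½`) — dag-n18-e's
`junkNE1 = ⟨PEmpty, junkTower, 0⟩` (evidence #5 on stmt-QuantumFields-20544, `n14At_junk`) is the instance. [folklore] -/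
theorem n14At_of_isEmpty (c : NE1pCarriers) [IsEmpty c.P] (hΛ : 0 ≤ c.Λ) : N14At c :=
  ⟨0, 0, 0, 1 / 2, ⟨le_rfl, le_rfl, le_rfl, zero_le_one, fun p => isEmptyElim p⟩, hΛ, by norm_num, by norm_num⟩

/-- Door 1 is CLOSED by the guard. [folklore] -/
theorem not_nondegenerate_of_isEmpty (c : NE1pCarriers) [IsEmpty c.P] : ¬ Nondegenerate c :=
  fun h => h.1.elim fun p => isEmptyElim p

/-- **DOOR 2 — NO BIRTHS** [decided]: `N14At` holds at every carriers whose bookings have no births at all, `0 ≤ Λ`. [folklore] -/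
theorem n14At_of_births_isEmpty (c : NE1pCarriers) (h : ∀ (p : c.P) (K : ℕ), IsEmpty (c.𝒯.B p K).Birth) (hΛ : 0 ≤ c.Λ) : N14At c :=
  ⟨0, 0, 0, 1 / 2, ⟨le_rfl, le_rfl, le_rfl, zero_le_one, fun p K b => ((h p K).false b).elim⟩, hΛ, by norm_num, by norm_num⟩

/-- Door 2 is CLOSED by `BirthsNonempty` (given one run parameter). [folklore] -/
theorem not_birthsNonempty_of_births_isEmpty {P : Type*} (𝒯 : DressedTower P) [Nonempty P] (h : ∀ (p : P) (K : ℕ), IsEmpty (𝒯.B p K).Birth) :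
    ¬ BirthsNonempty 𝒯 := by
  intro hb
  obtain ⟨p⟩ := ‹Nonempty P›
  obtain ⟨b⟩ := hb p 0
  exact (h p 0).false b

/-- … hence by the guard (and a fortiori by the per-scale variant). [folklore] -/
theorem not_nondegenerate_of_births_isEmpty (c : NE1pCarriers) (h : ∀ (p : c.P) (K : ℕ), IsEmpty (c.𝒯.B p K).Birth) : ¬ Nondegenerate c :=
  fun hn => haveI := hn.1; not_birthsNonempty_of_births_isEmpty c.𝒯 h hn.2.1

/-- **DOOR 3 — THE VACUUM** [decided]: `N14At` holds at every carriers all of whose booked sizes vanish, `0 ≤ Λ` (any births, any index). [folklore] -/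
theorem n14At_of_size_eq_zero (c : NE1pCarriers) (h : ∀ (p : c.P) (K : ℕ) (b : (c.𝒯.B p K).Birth) (k : ℕ), (c.𝒯.B p K).size b k = 0) (hΛ : 0 ≤ c.Λ) :
    N14At c :=
  ⟨0, 0, 0, 1 / 2, ⟨le_rfl, le_rfl, le_rfl, zero_le_one, fun p K b k _ _ => by
    rw [h p K b k]; exact twoRate_nonneg le_rfl le_rfl le_rfl _ _ _⟩, hΛ, by norm_num, by norm_num⟩

/-- Door 3 is CLOSED by `NotVacuum`. [folklore] -/
theorem not_notVacuum_of_size_eq_zero {P : Type*} (𝒯 : DressedTower P) (h : ∀ (p : P) (K : ℕ) (b : (𝒯.B p K).Birth) (k : ℕ), (𝒯.B p K).size b k = 0) :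
    ¬ NotVacuum 𝒯 := by
  rintro ⟨p, K, b, k, -, -, hpos⟩
  rw [h p K b k] at hpos
  exact lt_irrefl 0 hpos

/-- … hence by the guard (and a fortiori by the per-scale variant). [folklore] -/
theorem not_nondegenerate_of_size_eq_zero (c : NE1pCarriers) (h : ∀ (p : c.P) (K : ℕ) (b : (c.𝒯.B p K).Birth) (k : ℕ), (c.𝒯.B p K).size b k = 0) :
    ¬ Nondegenerate c :=
  fun hn => not_notVacuum_of_size_eq_zero c.𝒯 h hn.2.2

/-- **WHAT THE GUARD DOES NOT CLOSE** [decided]: the owner's `toyTower` (one family born at scale `0` per cutoff, positive sizes `(½)^k(½)^K`) PASSES the guard at any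
`Λ` — a guard excludes junk, it does not single out Bałaban's run (its `N14At ⟨Unit, toyTower, 2⟩`, dag-n14-a's `n14At_toyTower`, was never offered as the tower of
record). [folklore] -/
theorem nondegenerate_toyTower (Λ : ℝ) : Nondegenerate ⟨Unit, toyTower, Λ⟩ :=
  ⟨⟨()⟩, fun _ _ => ⟨()⟩, ⟨(), 0, (), 0, le_rfl, le_rfl, toy_size_pos 0 0 ()⟩⟩

/-- … and FAILS only the per-scale variant: at cutoff `1` no member of `toyTower` has scale `1`. [folklore] -/
theorem not_memberPerScale_toyTower : ¬ MemberPerScale toyTower := by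
  intro h
  obtain ⟨b, hb⟩ := h () 1 1 le_rfl
  change (0 : ℕ) = 1 at hb
  exact absurd hb (by norm_num)

/-- The keyed guard FAILS for a reading whose `ne1` has an empty index at ONE admissible tuple with provisos in the regime. [folklore] -/
theorem not_ne1NondegenerateOn_of_isEmpty (𝔯 : RateReading₁₃CoPH N) (Rg : (F : T4Family) → Stage13HParams F N → Prop) {F : T4Family}
    (θ : Stage13HParams F N) (hP : θ.Provisos₁₃CoPH F N) (hRg : Rg F θ) (hθ : θ.Admissible F N) (g₀ : ℕ → ℝ) (os : List (ULoop F))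
    (h : IsEmpty (𝔯.ne1 F θ hP g₀ os).P) : ¬ Ne1NondegenerateOn 𝔯 Rg :=
  fun hn => not_nondegenerate_of_isEmpty _ (hn F θ hP hRg hθ g₀ os)

end Junk

/-! ## §3 A guard-passing inhabitant over the record's boxes carrying `N14At`, at the Stage-13 keys (dag-n14-c's decoupled tower, by name) -/

section OverBoxes

/-- **THE POINTS OF THE RECORD's COUPLING BOXES** [data]: a run length `k` and a coupling history `v ∈ FlowStep.Box γ k` (`= ∏ (0, γ]`). [folklore] -/
def BoxPt (γ : ℝ) : Type := Σ k : ℕ, {v : Fin (k + 1) → ℝ // v ∈ FlowStep.Box γ k}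

/-- The boxes of a positive window radius are inhabited (the constant history `γ` of length `1`). [folklore] -/
theorem nonempty_boxPt {γ : ℝ} (hγ : 0 < γ) : Nonempty (BoxPt γ) :=
  ⟨⟨0, fun _ => γ, FlowStep.mem_box.mpr fun _ => ⟨hγ, le_rfl⟩⟩⟩

/-- Conversely an inhabited box forces `0 < γ`. [folklore] -/
theorem gamma_pos_of_nonempty_boxPt {γ : ℝ} (h : Nonempty (BoxPt γ)) : 0 < γ := by
  obtain ⟨⟨k, v, hv⟩⟩ := h
  obtain ⟨h0, hγ⟩ := FlowStep.mem_box.mp hv 0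
  exact h0.trans_le hγ

variable {Z : Type} [MeasurableSpace Z]

/-- **THE DECOUPLED TOWER RE-INDEXED OVER THE RECORD's BOXES × THE SOURCE WINDOW** [model]: run parameter = (box point, source `t`, `‖t‖ ≤ l₀`); the booking at
`(q, t)` and cutoff `K` is dag-n14-c's `Decoupled.booking R t K` — the box coordinate is IDLE (the caricature is blind to the coupling history; the tower OF RECORD
would book `(ℝ′𝕋)^k(ρ₀·f_μ)` along `v` — NODE O). [folklore] -/
def towerOverBoxes (R : DecoupledRun Z) (γ : ℝ) : DressedTower (BoxPt γ × Decoupled.Window R.l₀) where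
  B := fun p K => booking R p.2.val K
  K_eq := fun _ _ => rfl
  T := fun p K => trajectory R p.2.val K

/-- Its carriers at positional rate `Λ`. [model] -/
def carriersOverBoxes (R : DecoupledRun Z) (γ Λ : ℝ) : NE1pCarriers :=
  ⟨BoxPt γ × Decoupled.Window R.l₀, towerOverBoxes R γ, Λ⟩

/-- **THE READING OF N14's CARRIERS OVER THE RECORD's BOXES** [model]: at the Stage-13 tuple `θ` the carriers over the boxes of ITS window radius `θ.γ` (reads `θ`;
`hP`, `g₀`, `os` idle in the caricature). [folklore] -/
def ne1OverBoxes (R : DecoupledRun Z) (Λ : ℝ) :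
    (F : T4Family) → (θ : Stage13HParams F N) → θ.Provisos₁₃CoPH F N → (ℕ → ℝ) → List (ULoop F) → NE1pCarriers :=
  fun _ θ _ _ _ => carriersOverBoxes R θ.γ Λ

/-- Every scale has its member: the birth `j` of dag-n14-c's booking. [folklore] -/
theorem memberPerScale_tower (R : DecoupledRun Z) : MemberPerScale (tower R) :=
  fun _ _ j hj => ⟨⟨j, Nat.lt_succ_of_le hj⟩, rfl⟩

/-- … and so does the re-indexed tower. [folklore] -/
theorem memberPerScale_towerOverBoxes (R : DecoupledRun Z) (γ : ℝ) : MemberPerScale (towerOverBoxes R γ) :=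
  fun _ _ j hj => ⟨⟨j, Nat.lt_succ_of_le hj⟩, rfl⟩

/-- The class with its constants on the re-indexed tower (dag-n14-c's `classAt_tower` per booking). [folklore] -/
theorem dressedStabilityWith_towerOverBoxes (R : DecoupledRun Z) (γ : ℝ) : DressedStabilityWith (towerOverBoxes R γ) (amp R) 1 R.θ :=
  ⟨Decoupled.amp_nonneg R, zero_le_one, R.hθ0, R.hθ1.le, fun p K => Decoupled.classAt_tower R p.2 K⟩

/-- ROOT-C of record on the re-indexed tower for `0 ≤ Λ`, `Λ·θ < 1` (`dressedStabilityStrict_of_with` BY NAME, `r = Λ·θ`). [folklore] -/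
theorem dressedStabilityStrict_towerOverBoxes (R : DecoupledRun Z) (γ : ℝ) {Λ : ℝ} (hΛ : 0 ≤ Λ) (hΛθ : Λ * R.θ < 1) :
    DressedStabilityStrict (towerOverBoxes R γ) Λ :=
  dressedStabilityStrict_of_with (r := Λ * R.θ) (dressedStabilityWith_towerOverBoxes R γ) hΛ (by rw [mul_one]) hΛθ

/-- **THE NODE STATEMENT AT THE CARRIERS OVER THE BOXES** [by name]: `N14At (carriersOverBoxes R γ Λ)` for `0 ≤ Λ`, `Λ·θ < 1`. [folklore] -/
theorem n14At_carriersOverBoxes (R : DecoupledRun Z) (γ : ℝ) {Λ : ℝ} (hΛ : 0 ≤ Λ) (hΛθ : Λ * R.θ < 1) : N14At (carriersOverBoxes R γ Λ) :=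
  dressedStabilityStrict_towerOverBoxes R γ hΛ hΛθ

/-- The rate clause at every `Λ ≥ 1` with multiplicity `1` (dag-n14-c's `positionalCount_tower`). [folklore] -/
theorem rateCovers_carriersOverBoxes (R : DecoupledRun Z) (γ : ℝ) {Λ : ℝ} (hΛ : 1 ≤ Λ) : RateCovers (carriersOverBoxes R γ Λ) 1 :=
  ⟨zero_le_one, fun p K => Decoupled.positionalCount_tower R p.2 K hΛ⟩

/-- The depth-`n` half-amplitude `½·(½)ⁿ` of the two-point fibre piece. [decided toy] -/
def halfAmp (n : ℕ) : ℝ := 1 / 2 * (1 / 2) ^ n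

/-- It is positive. [folklore] -/
theorem halfAmp_pos (n : ℕ) : 0 < halfAmp n := by
  unfold halfAmp; positivity

/-- The tilted normalisation of the two-point run at EVERY depth `n` and real source `x`: `e^{x·aₙ} + e^{−x·aₙ}`, `aₙ = ½(½)ⁿ` (n14-c's `tiltNorm_twoPoint_zero` is
`n = 0`). [folklore] -/
theorem tiltNorm_twoPoint (n : ℕ) (x : ℝ) :
    tiltNorm twoPointMeasure (fun _ => (1 : ℝ)) (fun _ => (0 : ℂ)) (twoPointW n) (x : ℂ) =
      ((Real.exp (x * halfAmp n) + Real.exp (-(x * halfAmp n)) : ℝ) : ℂ) := by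
  have e1 : (0 : ℂ) + (x : ℂ) * twoPointW n true = ((x * halfAmp n : ℝ) : ℂ) := by
    simp only [twoPointW, if_true, halfAmp]; push_cast; ring
  have e2 : (0 : ℂ) + (x : ℂ) * twoPointW n false = ((-(x * halfAmp n) : ℝ) : ℂ) := by
    simp only [twoPointW, Bool.false_eq_true, if_false, halfAmp]; push_cast; ring
  rw [tiltNorm_def, Decoupled.integral_twoPoint, tiltWeight_apply, tiltWeight_apply, e1, e2]
  push_cast
  ring

/-- **EVERY SCALE's MEMBER IS A NONZERO TERM AT SOURCE `1`** [non-degeneracy]: the depth-`n` born term of the two-point run at `t = 1` is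
`log(e^{aₙ} + e^{−aₙ}) − log 2 = log cosh aₙ > 0`. [folklore] -/
theorem birthSize_twoPoint_pos (n : ℕ) : 0 < birthSize twoPoint n 1 := by
  unfold birthSize
  rw [norm_pos_iff]
  show dressLog twoPointMeasure (fun _ => (1 : ℝ)) (fun _ => (0 : ℂ)) (twoPointW n) 1 - 1 * (0 : ℂ) ≠ 0
  rw [mul_zero, sub_zero, dressLog]
  have h1 := tiltNorm_twoPoint n 1
  have h0 := tiltNorm_twoPoint n 0
  rw [Complex.ofReal_one, one_mul] at h1
  rw [Complex.ofReal_zero, zero_mul, neg_zero, Real.exp_zero] at h0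
  rw [h1, h0]
  have hpos1 : 0 < Real.exp (halfAmp n) + Real.exp (-halfAmp n) := by positivity
  have hpos0 : (0 : ℝ) < 1 + 1 := by norm_num
  rw [← Complex.ofReal_log hpos1.le, ← Complex.ofReal_log hpos0.le, ← Complex.ofReal_sub, Complex.ofReal_ne_zero, sub_ne_zero]
  intro heq
  have h := Real.log_injOn_pos hpos1 hpos0 heq
  have hcosh : Real.exp (halfAmp n) + Real.exp (-halfAmp n) = 2 * Real.cosh (halfAmp n) := by
    rw [Real.cosh_eq]; ring
  have hgt : (1 : ℝ) < Real.cosh (halfAmp n) := Real.one_lt_cosh.mpr (halfAmp_pos n).ne'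
  rw [hcosh] at h
  linarith

/-- Source `1` lies in the two-point run's window (`l₀ = 1`). [decided toy] -/
theorem norm_one_le_twoPoint_l₀ : ‖(1 : ℂ)‖ ≤ twoPoint.l₀ := by
  show ‖(1 : ℂ)‖ ≤ 1
  simp

/-- At source `1`, EVERY booked size of the two-point tower over the boxes is positive (all cutoffs, all members, all scales). [folklore] -/
theorem size_pos_towerOverBoxes_twoPoint {γ : ℝ} (q : BoxPt γ) (K : ℕ) (b : ((towerOverBoxes twoPoint γ).B (q, ⟨1, norm_one_le_twoPoint_l₀⟩) K).Birth)
    (k : ℕ) : 0 < ((towerOverBoxes twoPoint γ).B (q, ⟨1, norm_one_le_twoPoint_l₀⟩) K).size b k :=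
  birthSize_twoPoint_pos _

/-- The two-point tower over the boxes of a positive radius is not the vacuum. [folklore] -/
theorem notVacuum_towerOverBoxes_twoPoint {γ : ℝ} (hγ : 0 < γ) : NotVacuum (towerOverBoxes twoPoint γ) := by
  obtain ⟨q⟩ := nonempty_boxPt hγ
  exact ⟨(q, ⟨1, norm_one_le_twoPoint_l₀⟩), 0, ⟨0, Nat.zero_lt_one⟩, 0, le_rfl, le_rfl, size_pos_towerOverBoxes_twoPoint q 0 _ 0⟩

/-- **THE PER-SCALE VARIANT HOLDS at the two-point carriers over the boxes of every positive radius** (any `Λ`). [folklore] -/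
theorem nondegeneratePerScale_carriersOverBoxes_twoPoint {γ : ℝ} (Λ : ℝ) (hγ : 0 < γ) : NondegeneratePerScale (carriersOverBoxes twoPoint γ Λ) := by
  obtain ⟨q⟩ := nonempty_boxPt hγ
  exact ⟨⟨(q, ⟨1, norm_one_le_twoPoint_l₀⟩)⟩, memberPerScale_towerOverBoxes _ _, notVacuum_towerOverBoxes_twoPoint hγ⟩

/-- **… hence THE GUARD HOLDS there** (any `Λ`). [folklore] -/
theorem nondegenerate_carriersOverBoxes_twoPoint {γ : ℝ} (Λ : ℝ) (hγ : 0 < γ) : Nondegenerate (carriersOverBoxes twoPoint γ Λ) :=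
  nondegenerate_of_perScale (nondegeneratePerScale_carriersOverBoxes_twoPoint Λ hγ)

/-- Conversely the guard at these carriers forces the radius to be positive — the index is genuinely over the boxes. [folklore] -/
theorem gamma_pos_of_nondegenerate_carriersOverBoxes (R : DecoupledRun Z) {γ Λ : ℝ} (h : Nondegenerate (carriersOverBoxes R γ Λ)) : 0 < γ := by
  obtain ⟨⟨q, -⟩⟩ := h.1
  exact gamma_pos_of_nonempty_boxPt ⟨q⟩

/-- **THE KEYED GUARD HOLDS FOR THE READING OVER THE BOXES** at EVERY admissible Stage-13 tuple with provisos, in every regime, for every Literature-typed `lit`: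
admissibility gives `0 < θ.γ` (`Stage9Params.Admissible.gamma_pos` through the parent projections). [folklore] -/
theorem ne1NondegenerateOn_ne1OverBoxes_twoPoint
    (lit : (F : T4Family) → (θ : Stage13HParams F N) → θ.Provisos₁₃CoPH F N → (ℕ → ℝ) → List (ULoop F) → Node00.RateObjects₁₁ N)
    (Rg : (F : T4Family) → Stage13HParams F N → Prop) (Λ : ℝ) :
    Ne1NondegenerateOn ⟨lit, ne1OverBoxes twoPoint Λ⟩ Rg :=
  fun _ _ _ _ hθ _ _ => nondegenerate_carriersOverBoxes_twoPoint Λ hθ.toStage9.gamma_pos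

/-- **`S_N14` AT THE REGIME-RESTRICTED ₁₃ HOME FOR THE READING OVER THE BOXES** [one application of `s_N14_rRec₁₃CoPHOn_of_n14At`]: for `0 ≤ Λ`, `Λ·θ < 1`, every `lit`,
every regime.  A MODEL inhabitant of the slot — says nothing about Bałaban's run. [folklore] -/
theorem s_N14_rRec₁₃CoPHOn_ne1OverBoxes (R : DecoupledRun Z) {Λ : ℝ} (hΛ : 0 ≤ Λ) (hΛθ : Λ * R.θ < 1)
    (lit : (F : T4Family) → (θ : Stage13HParams F N) → θ.Provisos₁₃CoPH F N → (ℕ → ℝ) → List (ULoop F) → Node00.RateObjects₁₁ N)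
    (Rg : (F : T4Family) → Stage13HParams F N → Prop) :
    S_N14 (RRec₁₃CoPHOn ⟨lit, ne1OverBoxes R Λ⟩ Rg) :=
  s_N14_rRec₁₃CoPHOn_of_n14At _ Rg fun _ θ _ _ _ _ _ => n14At_carriersOverBoxes R θ.γ hΛ hΛθ

/-- **THE GUARDED SLOT IS JOINTLY SATISFIABLE WITH THE NODE STATEMENT AND THE RATE CLAUSE** [A6 hygiene, model]: at `Λ = 1` the two-point reading over the boxes
passes the keyed guard, covers its positional counts with multiplicity `1`, and carries `S_N14` at the regime-restricted home — for every `lit` and regime.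
NOT the tower of record; NOT a discharge of N14. [folklore] -/
theorem guard_and_s_N14_twoPoint
    (lit : (F : T4Family) → (θ : Stage13HParams F N) → θ.Provisos₁₃CoPH F N → (ℕ → ℝ) → List (ULoop F) → Node00.RateObjects₁₁ N)
    (Rg : (F : T4Family) → Stage13HParams F N → Prop) :
    Ne1NondegenerateOn ⟨lit, ne1OverBoxes twoPoint 1⟩ Rg ∧
      (∀ (F : T4Family) (θ : Stage13HParams F N) (hP : θ.Provisos₁₃CoPH F N) (g₀ : ℕ → ℝ) (os : List (ULoop F)),
        RateCovers (ne1OverBoxes (N := N) twoPoint 1 F θ hP g₀ os) 1) ∧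
      S_N14 (RRec₁₃CoPHOn ⟨lit, ne1OverBoxes twoPoint 1⟩ Rg) :=
  ⟨ne1NondegenerateOn_ne1OverBoxes_twoPoint lit Rg 1, fun _ θ _ _ _ => rateCovers_carriersOverBoxes twoPoint θ.γ le_rfl,
    s_N14_rRec₁₃CoPHOn_ne1OverBoxes twoPoint zero_le_one (by show (1 : ℝ) * (1 / 2) < 1; norm_num) lit Rg⟩

end OverBoxes

end YMDAG.N14.TowerGuard

end
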